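import Literature.Analysis.FluidPDE.KNSSOseenMildDecayOfLemma31
import Literature.Analysis.FluidPDE.KNSSWeakDriftMildProofs
import Literature.Analysis.FluidPDE.KNSSRegularityDecompositionHolds
import Literature.Analysis.FluidPDE.KNSSRegularityGluing
import HarnessLib

/-!
# Crux `FrequencyRigidity` (stmt-NavierStokesRegularity-2955), line `moving-adjoint-bernoulli`,
# stub `stub_mildFrameBounds` — helper: the continuous parasitic drift of a bounded classical
# flow on a window (KNSS 2009, Lemma 3.1, read on a classical solution)

Helper file (lands `--supports stmt-NavierStokesRegularity-2955`; theorems only). For all `L` and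
`T > 0` there is a constant `K = K(L, T)` such that every classical solution `(u, p)` of the
unforced Navier–Stokes system (`ν = 1`) on `ℝ³ × (0, T)` bounded by `L` admits a drift
`β : ℝ → ℝ³`, continuous on `(0, T)` and bounded by `K` there, with

  `u(t, y) − e^{(t−s)Δ}u(s)(y) + B¹_s(u, u)(t)(y) = β(t) − β(s)`   for all `0 < s < t < T`, all `y`:

the defect of the Oseen (mild) integral equation of `u` is a spatially constant, continuous
function of the two times (the increment of KNSS's parasitic drift `b`, §1 p. 3). Proof: KNSS's
Lemma 3.1 in drift-mild form (`KNSS2009_weak_driftMild_holds`) writes `u = U + b` a.e. with `(U, b)`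
drift-mild; the smoothing half of §4 (`KNSS2009_driftMild_regularity_holds`, (4.11) at order `0`)
makes `t ↦ U(t, y)` continuous, so `β(t) := u(t, 0) − U(t, 0)` is continuous and `u = U + β`
EVERYWHERE (continuity in `y` at good times, continuity in `t` and `Measure.eqOn_open_of_ae_eq`
for the rest); the drift-mild identity of `U` then reads as displayed (the Duhamel term only sees
`U + b = u`: `driftDuhamel_congr_ae`, `driftDuhamel_zero_eq_oseenDuhamel`; the caloric term of
`U(s) = u(s) − β(s)` is `e^{(t−s)Δ}u(s) − β(s)`), exactly as in the tree's
`oseenMild_of_cylRadius_decay_window` (KNSS Thm 6.1), minus the decay hypothesis.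

## References

* G. Koch, N. Nadirashvili, G. Seregin, V. Šverák, *Liouville theorems for the Navier–Stokes
  equations and applications*, Acta Math. 203 (2009) 83–105 = arXiv:0709.3599, §1 p. 3, §3
  Lemma 3.1 and Remark 3.1, §4 (4.11). [KochNadirashviliSereginSverak2009]
-/

set_option linter.dupNamespace false

noncomputable section

namespace Summit.NavierStokesRegularity.NavierStokesRegularity.Theorems.FrequencyRigidity.MovingAdjointBernoulli

open Literature.Analysis Literature.Analysis.FluidPDE MeasureTheory Set Filter Topology Function
open scoped ENNReal

local notation "E3" => EuclideanSpace ℝ (Fin 3)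

/-- A function continuous on an open set of `ℝ` and a.e. zero on it vanishes on it
(`Measure.eqOn_open_of_ae_eq`). [folklore] -/
private theorem eqOn_zero_of_ae {F : Type*} [NormedAddCommGroup F] {f : ℝ → F} {U : Set ℝ}
    (hU : IsOpen U) (hf : ContinuousOn f U)
    (hae : ∀ᵐ t ∂((volume : Measure ℝ).restrict U), f t = 0) : ∀ t ∈ U, f t = 0 := by
  have h : f =ᵐ[(volume : Measure ℝ).restrict U] fun _ => (0 : F) := hae
  exact Measure.eqOn_open_of_ae_eq h hU hf continuousOn_const

/-- **The continuous parasitic drift of a bounded classical flow on a window** (KNSS 2009,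
Lemma 3.1 read on a classical solution). For all `L`, `T > 0` there is `K` such that every
classical solution `(u, p)` of the unforced Navier–Stokes system (`ν = 1`) on `ℝ³ × (0, T)` with
`‖u‖ ≤ L` admits `β : ℝ → ℝ³`, continuous on `(0, T)` with `‖β(t)‖ ≤ K` there, such that
`u(t, y) − e^{(t−s)Δ}u(s)(y) + B¹_s(u,u)(t)(y) = β(t) − β(s)` for all `0 < s < t < T` and all `y`.
[cite: KochNadirashviliSereginSverak2009, §3 Lemma 3.1 and Remark 3.1, §4 (4.11) (arXiv:0709.3599 pp. 7–8)] -/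
private theorem exists_continuous_drift_window (L T : ℝ) (hT : 0 < T) :
    ∃ K : ℝ, ∀ (u : ℝ → E3 → E3) (p : ℝ → E3 → ℝ),
      IsClassicalNSSolutionOn (Ioo 0 T) 1 0 u p → (∀ t ∈ Ioo 0 T, ∀ x, ‖u t x‖ ≤ L) →
      ∃ β : ℝ → E3, ContinuousOn β (Ioo 0 T) ∧ (∀ t ∈ Ioo 0 T, ‖β t‖ ≤ K) ∧
        ∀ s t : ℝ, 0 < s → s < t → t < T → ∀ y : E3,
          u t y - UnboundedOperators.heatExtension (u s) (t - s) y + oseenDuhamel 1 s u u t y =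
            β t - β s := by
  obtain ⟨N, hN⟩ := KNSS2009_weak_driftMild_holds L T hT
  obtain ⟨Cr, Lr, hreg⟩ := KNSS2009_driftMild_regularity_holds N T hT
  refine ⟨L + N, fun u p hcl hL => ?_⟩
  -- ## basic facts about the classical solution
  have hcont : ContinuousOn (uncurry u) (Ioo 0 T ×ˢ univ) := hcl.smooth_velocity.continuousOn
  have hslice : ∀ τ ∈ Ioo 0 T, Continuous (u τ) := fun τ hτ =>
    hcont.comp_continuous (Continuous.prodMk_right τ) fun x => ⟨hτ, mem_univ x⟩
  have hline : ∀ y : E3, ContinuousOn (fun τ => u τ y) (Ioo 0 T) := fun y =>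
    hcont.comp (continuousOn_id.prodMk continuousOn_const) fun τ hτ => ⟨hτ, mem_univ y⟩
  have hE : Module.finrank ℝ E3 = 3 := finrank_euclideanSpace_fin
  -- ## Step 1: Lemma 3.1 and the regularity of the mild part
  have hbw : IsBoundedWeakNSSolutionOn (Ioo 0 T) isOpen_Ioo 1 u :=
    hcl.isBoundedWeakNSSolutionOn ⟨L, hL⟩
  obtain ⟨U, bd, hUb, hae⟩ := hN hbw hL
  obtain ⟨hsm, -, -, hlip, -⟩ := hreg hUb
  -- `t ↦ U t y` is continuous on `(0, T)` (Lipschitz on every `(δ, T)`)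
  have hUline : ∀ y : E3, ContinuousOn (fun τ => U τ y) (Ioo 0 T) := by
    intro y
    refine isOpen_Ioo.continuousOn_iff.2 fun τ hτ => ?_
    have hδ : 0 < τ / 2 := by linarith [hτ.1]
    have hc : ContinuousOn (fun τ => U τ y) (Ioo (τ / 2) T) :=
      continuousOn_apply_family (fun k s hs t ht x => hlip (τ / 2) hδ k s hs t ht x) y
    exact hc.continuousAt (Ioo_mem_nhds (by linarith [hτ.1]) hτ.2)
  -- ## Step 2: the continuous drift and the identity `u = U + β` everywhere
  set β : ℝ → E3 := fun τ => u τ 0 - U τ 0 with hβ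
  have hβc : ContinuousOn β (Ioo 0 T) := (hline 0).sub (hUline 0)
  have hgood : ∀ᵐ τ ∂((volume : Measure ℝ).restrict (Ioo 0 T)),
      ∀ y, u τ y - U τ y - (u τ 0 - U τ 0) = 0 := by
    filter_upwards [hae, ae_restrict_mem measurableSet_Ioo] with τ hτ hτm
    have hc2 : Continuous fun y => U τ y + bd τ := (hsm τ hτm).continuous.add continuous_const
    have heq : ∀ y, u τ y = U τ y + bd τ := fun y =>
      congr_fun ((Continuous.ae_eq_iff_eq volume (hslice τ hτm) hc2).1 hτ) y
    intro y
    rw [heq y, heq 0]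
    abel
  have hall : ∀ τ ∈ Ioo 0 T, ∀ y, u τ y = U τ y + β τ := by
    intro τ hτ y
    have hfc : ContinuousOn (fun σ => u σ y - U σ y - (u σ 0 - U σ 0)) (Ioo 0 T) :=
      ((hline y).sub (hUline y)).sub ((hline 0).sub (hUline 0))
    have hae' : ∀ᵐ σ ∂((volume : Measure ℝ).restrict (Ioo 0 T)),
        u σ y - U σ y - (u σ 0 - U σ 0) = 0 := by
      filter_upwards [hgood] with σ hσ using hσ y
    have h0 := eqOn_zero_of_ae isOpen_Ioo hfc hae' τ hτ
    show u τ y = U τ y + (u τ 0 - U τ 0)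
    rw [sub_eq_zero] at h0
    rw [← h0]
    abel
  -- ## Step 3: the bound
  have hβN : ∀ τ ∈ Ioo 0 T, ‖β τ‖ ≤ L + N := fun τ hτ =>
    (norm_sub_le _ _).trans (add_le_add (hL τ hτ 0) (hUb.norm_le τ hτ 0))
  refine ⟨β, hβc, hβN, fun s t hs hst htT y => ?_⟩
  -- ## Step 4: the drift-mild identity read on `u`
  have hsI : s ∈ Ioo 0 T := ⟨hs, hst.trans htT⟩
  have htI : t ∈ Ioo 0 T := ⟨hs.trans hst, htT⟩
  have hmildU := hUb.mild s t hs hst htT y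
  -- the caloric part
  have hUs : U s = fun z => u s z - β s := by
    funext z
    rw [hall s hsI z]
    abel
  have hheat : UnboundedOperators.heatExtension (U s) (t - s) y =
      UnboundedOperators.heatExtension (u s) (t - s) y - β s := by
    rw [hUs, UnboundedOperators.heatExtension_sub_of_bound (hslice s hsI) continuous_const (hL s hsI)
        (fun _ => le_rfl) (sub_pos.2 hst) y,
      UnboundedOperators.heatExtension_const _ (sub_pos.2 hst)]
  -- the Duhamel part
  have hdrift : driftDuhamel U bd s t y = oseenDuhamel 1 s u u t y := by
    have h1 : driftDuhamel U bd s t y = driftDuhamel u 0 s t y := by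
      refine driftDuhamel_congr_ae hst.le ?_ y
      have h2 : ∀ᵐ σ ∂((volume : Measure ℝ).restrict (Ioo s t)),
          u σ =ᵐ[volume] fun z => U σ z + bd σ :=
        ae_restrict_of_ae_restrict_of_subset (Ioo_subset_Ioo hs.le htT.le) hae
      filter_upwards [h2] with σ hσ
      filter_upwards [hσ] with z hz
      simp only [Pi.zero_apply, add_zero]
      exact hz.symm
    rw [h1]
    exact driftDuhamel_zero_eq_oseenDuhamel hE
      (fun σ hσ => (hslice σ ⟨hs.trans hσ.1, hσ.2.trans htT⟩).measurable)
      (fun σ hσ z => hL σ ⟨hs.trans hσ.1, hσ.2.trans htT⟩ z) hst.le y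
  have hUt : U t y = u t y - β t := by rw [hall t htI y]; abel
  rw [hUt, hheat, hdrift, sub_eq_iff_eq_add] at hmildU
  rw [hmildU]
  abel

/-- **The continuous parasitic drift on an arbitrary window `(a, b)`** (time translation of
the window `(0, T)`; registered helper statement of stub `stub_mildFrameBounds`): for all `L` and `T > 0` there is `K` such that every classical
solution `(u, p)` of the unforced Navier–Stokes system (`ν = 1`) on `ℝ³ × (a, a + T)` with `‖u‖ ≤ L`
admits `β`, continuous on `(a, a + T)` with `‖β‖ ≤ K` there, such that
`u(t, y) − e^{(t−s)Δ}u(s)(y) + B¹_s(u,u)(t)(y) = β(t) − β(s)` for all `a < s < t < a + T`, all `y`.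
[cite: KochNadirashviliSereginSverak2009, §3 Lemma 3.1 and Remark 3.1 (arXiv:0709.3599 p. 7)] -/
theorem mildFrame_continuousDrift_window : ∀ (L T : ℝ), 0 < T → ∃ K : ℝ, ∀ (a : ℝ) (u : ℝ → EuclideanSpace ℝ (Fin 3) → EuclideanSpace ℝ (Fin 3)) (p : ℝ → EuclideanSpace ℝ (Fin 3) → ℝ), Literature.Analysis.FluidPDE.IsClassicalNSSolutionOn (Set.Ioo a (a + T)) 1 0 u p → (∀ t ∈ Set.Ioo a (a + T), ∀ x : EuclideanSpace ℝ (Fin 3), ‖u t x‖ ≤ L) → ∃ β : ℝ → EuclideanSpace ℝ (Fin 3), ContinuousOn β (Set.Ioo a (a + T)) ∧ (∀ t ∈ Set.Ioo a (a + T), ‖β t‖ ≤ K) ∧ ∀ s t : ℝ, a < s → s < t → t < a + T → ∀ y : EuclideanSpace ℝ (Fin 3), u t y - Literature.Analysis.UnboundedOperators.heatExtension (u s) (t - s) y + Literature.Analysis.FluidPDE.oseenDuhamel 1 s u u t y = β t - β s := by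
  intro L T hT
  obtain ⟨K, hK⟩ := exists_continuous_drift_window L T hT
  refine ⟨K, fun a u p hcl hL => ?_⟩
  -- translate to the window `(0, T)`
  have h1 := hcl.comp_add_right a
  have hset : ((· + a) ⁻¹' Ioo a (a + T) : Set ℝ) = Ioo 0 T := by
    ext τ
    simp only [mem_preimage, mem_Ioo]
    constructor <;> intro h <;> constructor <;> linarith [h.1, h.2]
  rw [hset] at h1
  have hf : (fun t : ℝ => (0 : ℝ → E3 → E3) (t + a)) = 0 := by funext t; rfl
  rw [hf] at h1
  have hL' : ∀ t ∈ Ioo 0 T, ∀ x, ‖u (t + a) x‖ ≤ L := fun t ht x =>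
    hL (t + a) ⟨by linarith [ht.1], by linarith [ht.2]⟩ x
  obtain ⟨β, hβc, hβK, hβ⟩ := hK (fun t => u (t + a)) (fun t => p (t + a)) h1 hL'
  refine ⟨fun t => β (t - a), ?_, fun t ht => hβK (t - a) ⟨by linarith [ht.1], by linarith [ht.2]⟩,
    fun s t has hst ht y => ?_⟩
  · refine hβc.comp (continuousOn_id.sub continuousOn_const) fun t ht => ?_
    exact ⟨by linarith [ht.1], by linarith [ht.2]⟩
  · have key := hβ (s - a) (t - a) (by linarith) (by linarith) (by linarith) y
    rw [show t - a - (s - a) = t - s by ring] at key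
    simpa only [oseenDuhamel_translate, sub_add_cancel] using key

end Summit.NavierStokesRegularity.NavierStokesRegularity.Theorems.FrequencyRigidity.MovingAdjointBernoulli

end
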